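import Summits.BirchSwinnertonDyer.BirchSwinnertonDyer.Theorems.KatoDescentPotSupersingularReducibleKatoMemberOfFineInputsNoImai
import Summits.BirchSwinnertonDyer.BirchSwinnertonDyer.Theorems.KatoDescentPotSupersingularReducibleFineSelmerMuZeroCharForm
import HarnessLib

/-!
# 27962, THE O6 NODE BEHIND CRUX M AND U₀-red FROM {Fine, H2X⁺, FW} ⊕ THE CHARACTER FORM OF IWASAWA's `μ = 0` —
# LIM 2017 THM. 3.5 LEAVES THE TRUST BASE (route-free helper for crux M = stmt-BirchSwinnertonDyer-19196
# `ReducibleKatoMember`, K9 / K8-t′; seat `bsd-potss-rkm` g33)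

WHY.  After g32 the kernel trust base of crux M on all its rows was {`exists_isNewformOf`, `exists_memberHullZetaFineInputs` (Fine),
`exists_iwasawaH2Data_fineSelmerDual_embedding_count` (H2X⁺), `Lim2017.thm35_…`, `ferreroWashington1979_classicalMuVanishes`}.  Lim's
Thm. 3.5 (the `L`-form of Coates–Sujatha 2005 Thm. 3.4) served one purpose: Coates–Sujatha's statement (A) on the REDUCIBLE rows, where it
carries Ferrero–Washington from the abelian Borel field `ℚ(χ₁, χ₂)` up the degree-`p` step to `ℚ(E[p])` — Iwasawa's `p`-extension
ascent, hidden in the named fact.  This generation proved (A) on those rows DIRECTLY over the Borel field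
(`ReducibleFineSelmerMuZeroCharForm.fineSelmerDual_moduleFinite_of_not_irreducible_of_charForm`: dévissage along `0 → C → E[p] → E[p]/C → 0`
+ dialect bridge + Lim–Sujatha bricks) from FW and the CHARACTER FORM of Iwasawa's `μ = 0`
(`IwasawaTheory.classicalMuVanishes_finite_unramifiedClasses`: Lang GTM 121 Ch. 5 structure theory ∘ class field theory; an existing named
fact of the tree, typed by cell bsd-2adic) — so the whole chain re-keys:

* `muInvariant_H2_eq_zero_of_moduleFinite` / `nonempty_coreInputs_of_fineInputs_of_moduleFinite` — g30's §1/§2 with statement (A) for the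
  row as an ABSTRACT hypothesis (`∃ γ D, Module.Finite ℤ_[p] D.X`), so that any source of (A) plugs in;
* `exists_memberHullZetaCoreInputs_of_fineInputs_of_charForm` — **`Fine → H2X⁺ → char-form → FW → exists_memberHullZetaCoreInputs`**
  (27962 = `PublishedInputMemberHullZetaCore` on K9 / K8-t′ = U₀-red's `PublishedInputKatoCorePackageU0Red[T]`), every row, NO Imai, NO Lim;
* `katoMemberShaBoundOfReducible_of_newform_of_fineInputs_of_charForm` — the O6 node `O6.KatoMemberShaBoundOfReducible` (= crux M's decl
  on both routes) from {modularity, Fine, H2X⁺, char-form, FW};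
* `missingUpperBoundAt_of_fineInputs_of_charForm` — U₀-red's reducible upper half from the same atoms ⊕ {Cassels, GZK, entire `L`}.

HONEST FRAMING.  Theorems only; route-free; closes nothing by itself (crux M stays cite-level); BSD is proved for no curve.  TRUST BASE of
crux M after this file, in the kernel, on ALL rows: {`exists_isNewformOf`, `exists_memberHullZetaFineInputs`,
`exists_iwasawaH2Data_fineSelmerDual_embedding_count`, `ferreroWashington1979_classicalMuVanishes`,
`IwasawaTheory.classicalMuVanishes_finite_unramifiedClasses`} — Kato's Euler-system theorems, Ferrero–Washington, and the structure
theory of the classical unramified Iwasawa module; no elliptic-curve-specific Iwasawa-theoretic fact beyond Kato's.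

References: [Kato2004Asterisque] Thm. 12.5 (pp. 221–222), Cor. 14.3, Thm. 14.5 (pp. 235–236), (14.9.1)–(14.9.3) (pp. 239–240), §14.14
(p. 243), Prop. 14.16 (2) (pp. 244–245); [Wuthrich2014] Lemma 14 (p. 396); [CoatesSujatha2005] Thm. 3.4, Cor. 3.6; [Lang1990] Ch. 5 §§1–4;
[FerreroWashington1979]; tree: `…ReducibleFineSelmerMuZeroCharForm.lean`, `…ReducibleKatoMemberOfFineInputsNoImai.lean` (g32),
`…MemberHullCoreInputsOfFine.lean` (g30).
-/

-- the summit and its single problem are both named `BirchSwinnertonDyer` (registry layout D-0017)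
set_option linter.dupNamespace false
set_option autoImplicit false

noncomputable section

open scoped Classical NumberField TensorProduct
open Function Field NumberField IsDedekindDomain WeierstrassCurve CongruenceSubgroup
open Literature.NumberTheory.EllipticCurves Literature.NumberTheory.EllipticCurves.GreenbergSelmer
open Literature.NumberTheory.GaloisRepresentations Literature.NumberTheory.GaloisCohomology
open Literature.NumberTheory.EllipticCurves.ModularForms
open Literature.NumberTheory.EllipticCurves.Kato2004 Literature.NumberTheory.EllipticCurves.Kato2004.EulerSystemValues
open Literature.NumberTheory.EllipticCurves.IwasawaAlgebra Literature.NumberTheory.EllipticCurves.IwasawaDual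
open Literature.NumberTheory.EllipticCurves.Rank1Residual Literature.NumberTheory.EllipticCurves.Rank1Residual.Typed
open Literature.NumberTheory.IwasawaTheory
open Summit.BirchSwinnertonDyer.Rank1Residual Summit.BirchSwinnertonDyer.Rank1Residual.Additive
open Summit.BirchSwinnertonDyer.BirchSwinnertonDyer.Theorems
open Summit.BirchSwinnertonDyer.BirchSwinnertonDyer.Theorems.IntegralH1LayerZeroTop

universe u

namespace Summit.BirchSwinnertonDyer.BirchSwinnertonDyer.Theorems.FineInputsCharForm

/-! ## §1 `μ(J.H2) = 0` and the core package per pin, with statement (A) for the row as an abstract hypothesis -/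

section Mu

variable (W : WeierstrassCurve ℚ) [W.IsElliptic] (p : ℕ) [Fact p.Prime]
  [ContinuousSMul ℤ_[p] (W.tateModule p)] {κ : ZpExtension ℚ p} {γ : absoluteGaloisGroup ℚ}

/-- **`μ(J.H2) = 0` from statement (A) for the row** (`(κ, γ)` a pinned `ℤ_p`-extension): for every descent package
`J : IwasawaH2Data W p κ γ I` and every injective `Λ`-linear `X₀ → J.H2` of finite cokernel, if the dual fine Selmer group of `W` over
`ℚ_∞` is finitely generated over `ℤ_p` (`∃ γ' D, Module.Finite ℤ_[p] D.X`), then `muInvariant p J.H2 = 0` (g30's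
`CoreInputsOfFine.muInvariant_H2_eq_zero_of_fineSelmerDual_embedding` with its (A)-input abstracted: `ℓ_{(p)}(X₀) = 0` and an injection
with finite cokernel preserves lengths at height one). [cite: Kato2004Asterisque, §13.3–13.4 (μ-invariant), §14.14 (p. 243)]
[cite: Washington1997, §13.2] -/
theorem muInvariant_H2_eq_zero_of_moduleFinite
    (hA : ∃ (γ' : absoluteGaloisGroup ℚ) (D : W.FineSelmerDualData κ γ'),
      Module.Finite ℤ_[p] (RestrictScalars ℤ_[p] (IwasawaAlgebra p) D.X))
    (hγ : κ.IsTopGenerator γ) {I : IwasawaH1Data W p κ γ} (J : IwasawaH2Data W p κ γ I)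
    (eX : (W.fineSelmerDualData κ hγ).X →ₗ[IwasawaAlgebra p] J.H2) (heX : Function.Injective eX)
    (hcokX : Finite (J.H2 ⧸ LinearMap.range eX)) :
    muInvariant p J.H2 = 0 := by
  have hfinp : Set.Finite {t : W.fineSelmerInfty κ | p • t = 0} :=
    (IwasawaModuleFinitePadicInt.exists_fineSelmerDualData_moduleFinite_iff_finite_pTorsion W κ hγ).mp hA
  haveI : Module.Finite (IwasawaAlgebra p) (W.fineSelmerDualData κ hγ).X :=
    (W.fineSelmerDualData κ hγ).module_finite_of_finite_pTorsion hγ hfinp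
  haveI : Finite ((W.fineSelmerDualData κ hγ).X ⧸
      (IwasawaAlgebra.augIdealP p • (⊤ : Submodule (IwasawaAlgebra p) (W.fineSelmerDualData κ hγ).X))) :=
    (W.fineSelmerDualData κ hγ).finite_quotient_augIdealP_of_finite_pTorsion hfinp
  unfold muInvariant
  refine finsum_mem_of_eqOn_zero fun 𝔭 h𝔭 => ?_
  have h𝔭' : 𝔭.asIdeal = augIdealP p := h𝔭
  have hht : 𝔭.asIdeal.height ≤ 1 := by rw [h𝔭']; exact le_of_eq (height_augIdealP_holds p)
  rw [Pi.zero_apply, ← lengthAt_eq_of_injective_of_finite_quotient eX heX hcokX 𝔭 hht,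
    Rank1Residual.KatoMuSkeleton.lengthAt_eq_zero_of_finite_quotient_p (M := (W.fineSelmerDualData κ hγ).X) 𝔭 h𝔭']
  rfl

/-- **Per pin, `MemberHullZetaFineInputs` ⊕ (`J`, `e_X`) ⊕ (c2′) for `J` ⟹ `MemberHullZetaCoreInputs`, given statement (A) for the row.**
[cite: Kato2004Asterisque, Thm. 12.5 (3) (p. 222), (14.9.1) (p. 239), §14.14 (14.14.1)–(14.14.2) (p. 243)] -/
theorem nonempty_coreInputs_of_fineInputs_of_moduleFinite
    (hA : ∃ (γ' : absoluteGaloisGroup ℚ) (D : W.FineSelmerDualData κ γ'),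
      Module.Finite ℤ_[p] (RestrictScalars ℤ_[p] (IwasawaAlgebra p) D.X))
    (hγ : κ.IsTopGenerator γ) {I : IwasawaH1Data W p κ γ} {y : I.H} (Z : MemberHullZetaFineInputs W p κ γ hγ I y)
    (J : IwasawaH2Data W p κ γ I)
    (eX : (W.fineSelmerDualData κ hγ).X →ₗ[IwasawaAlgebra p] J.H2) (heX : Function.Injective eX)
    (hcokX : Finite (J.H2 ⧸ LinearMap.range eX)) (hcount : KatoH2CountAt W p (Nat.card (coinvariants p J.H2))) :
    Nonempty (MemberHullZetaCoreInputs W p κ γ I y) :=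
  ⟨Z.toCoreInputs J eX heX hcokX (muInvariant_H2_eq_zero_of_moduleFinite W p hA hγ J eX heX hcokX) hcount⟩

end Mu

/-! ## §2 27962 from {Fine, H2X⁺, char-form, FW} — no Imai, no Lim -/

/-- **`exists_memberHullZetaFineInputs → H2X⁺ → char-form μ = 0 → FW → exists_memberHullZetaCoreInputs`** — the held core package
27962 on every row: g32's `FineInputsNoImai.exists_memberHullZetaCoreInputs_of_fineInputs` with `μ(X₀) = 0` on the reducible row supplied by
`ReducibleFineSelmerMuZeroCharForm.fineSelmerDual_moduleFinite_of_not_irreducible_of_charForm` (dévissage over the Borel field) instead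
of Lim 2017 Thm. 3.5. [cite: Kato2004Asterisque, Thm. 12.5 (1)–(3) (pp. 221–222), Cor. 14.3 and Thm. 14.5 (pp. 235–236), (14.9.1) (p. 239), (14.9.3) (p. 240), §14.14 (p. 243), Prop. 14.16 (2) (pp. 244–245)]
[cite: Wuthrich2014, Lemma 14 (p. 396)] [cite: CoatesSujatha2005, Cor. 3.6] -/
theorem exists_memberHullZetaCoreInputs_of_fineInputs_of_charForm (hF : exists_memberHullZetaFineInputs)
    (hH : exists_iwasawaH2Data_fineSelmerDual_embedding_count)
    (hchar : classicalMuVanishes_finite_unramifiedClasses)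
    (hFW : ferreroWashington1979_classicalMuVanishes) :
    exists_memberHullZetaCoreInputs := by
  intro W _ _ p _ hp hgood hmult hj hirr hL hsha
  have hpp : p.Prime := Fact.out
  have hPT : poitouTate_selmerStructure_duality ℚ :=
    poitouTate_selmerStructure_duality_of_conj (InputsPoitouTateSelmer.poitouTate_selmerStructure_duality_conj_holds ℚ)
  obtain ⟨W', hW'e, hW'm, hiso, hrest⟩ := hF W p hp hgood hmult hj hirr hL hsha
  haveI := hW'e
  haveI := hW'm
  -- transports along the isogeny `W ∼ W'`
  have hirr' : ¬ W'.HasIrreducibleModPGaloisRep p := Rank1Residual.not_hasIrreducibleModPGaloisRep_of_isIsogenous hiso hirr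
  obtain ⟨φ⟩ := hiso
  have hj' : 0 ≤ padicValRat p W'.j := padicValRat_j_nonneg_of_isogeny φ hpp hj
  have hshaW' : W'.ShaFinite := (show IsIsogenous W W' from ⟨φ⟩).shaFinite_iff_shaFinite.mp hsha
  haveI : Finite W'.sha := hshaW'
  refine ⟨W', hW'e, hW'm, ⟨φ⟩, ?_⟩
  intro _ _ _ N _ f hf ι
  obtain ⟨κ', Λ', c, d, a, A, z, x, hκ', hA, hc, hd, hZB, hall⟩ := hrest f hf ι
  refine ⟨κ', Λ', c, d, a, A, z, x, hκ', hA, hc, hd, hZB, ?_⟩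
  intro κ γ hκ hγ I y hy
  obtain ⟨Z⟩ := hall κ γ hκ hγ I y hy
  -- the place of `ℚ` at `p` and the finiteness at the member: a THEOREM at every potentially good odd prime
  let v : HeightOneSpectrum (𝓞 ℚ) := Rat.HeightOneSpectrum.primesEquiv.symm ⟨p, hpp⟩
  have hv : ((Rat.HeightOneSpectrum.primesEquiv v : Nat.Primes) : ℕ) = p := by
    simp only [v, Equiv.apply_symm_apply]
  have hfin : Finite (FixedPoints.addSubgroup ↥(κ.kerSubgroup ⊓ decomp v) (W'.geomPrimaryTorsion p)) :=
    TowerTorsionFiniteOrdinary.finite_fixedPoints_kerSubgroup_inf_decomp_of_padicValRat_j_nonneg W' p hp hj' κ hκ v hv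
  -- `W'(ℚ)` finite from clause (b′) of the package; `Ш(W')[p^∞]` finite from `Ш(W)` finite
  haveI : Finite W'.toAffine.Point := by
    obtain ⟨q, -, e, -, hZL⟩ := Z.zetaLineIndex
    exact ZetaLineRankZero.finite_point_of_zetaLineOrthIndexAt W' p hPT hp
      (layerZeroToTop_mem_integralH1 W' p κ (I.proj_mem 0 y)) hZL
  haveI : Finite (AddCommGroup.primaryComponent W'.sha p) := inferInstance
  -- statement (A) on the reducible row at the member, from the char-form fact and FW (no Lim 3.5)
  have hAW' := ReducibleFineSelmerMuZeroCharForm.fineSelmerDual_moduleFinite_of_not_irreducible_of_charForm hchar hFW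
    W' p hp hirr' κ hκ
  -- H2X⁺ at the member, and the assembly of the core package
  obtain ⟨J, eX, heX, hcokX, hcnt⟩ := hH W' p κ γ hγ v hp hκ hv hfin I
  exact nonempty_coreInputs_of_fineInputs_of_moduleFinite W' p hAW' hγ Z J eX heX hcokX
    (hcnt inferInstance inferInstance)

/-- **THE O6 NODE BEHIND CRUX M (`O6.KatoMemberShaBoundOfReducible` = `ReducibleKatoMember` on K9 and K8-t′) from modularity, Fine,
H2X⁺, the char-form `μ = 0` and FW — NO Lim, NO Imai, ALL rows.** [cite: Kato2004Asterisque, Thm. 12.6 (p. 222), Prop. 14.16 (2) (pp. 244–245)]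
[cite: Wuthrich2014, Lemma 14 (p. 396)] -/
theorem katoMemberShaBoundOfReducible_of_newform_of_fineInputs_of_charForm (hmod : exists_isNewformOf)
    (hF : exists_memberHullZetaFineInputs) (hH : exists_iwasawaH2Data_fineSelmerDual_embedding_count)
    (hchar : classicalMuVanishes_finite_unramifiedClasses)
    (hFW : ferreroWashington1979_classicalMuVanishes) :
    Rank1Residual.O6.KatoMemberShaBoundOfReducible :=
  ZetaLineRankZero.katoMemberShaBoundOfReducible_of_newform_of_coreInputs hmod
    (exists_memberHullZetaCoreInputs_of_fineInputs_of_charForm hF hH hchar hFW)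

/-- **U₀-red's reducible upper half (`MissingUpperBoundAt` at `r_an = 0`) from the same atoms — NO Lim, NO Imai** (U₀-red's other held
inputs as in the prequel). [cite: Kato2004Asterisque, §14.14 (p. 243), proof of Prop. 14.16 (pp. 244–245)] -/
theorem missingUpperBoundAt_of_fineInputs_of_charForm (hne : Kato2004.nonempty_iwasawaH1Data) (hmod : exists_isNewformOf)
    (hF : exists_memberHullZetaFineInputs) (hH : exists_iwasawaH2Data_fineSelmerDual_embedding_count)
    (hchar : classicalMuVanishes_finite_unramifiedClasses)
    (hFW : ferreroWashington1979_classicalMuVanishes)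
    (hCassels : bsdRHS_eq_of_isIsogenous) (hGZK : rank_eq_analyticRank_of_analyticRank_le_one)
    (hmodL : hasEntireLFunction_rat)
    (W : WeierstrassCurve ℚ) [W.IsElliptic] [W.IsGloballyMinimal] (p : ℕ) [Fact p.Prime]
    (hp : p ≠ 2) (hng : ¬ W.HasGoodReductionAtPrime p) (hnm : ¬ W.HasMultiplicativeReductionAtPrime p)
    (hj : 0 ≤ padicValRat p W.j) (hred : ¬ W.HasIrreducibleModPGaloisRep p)
    (hr : W.analyticRank = 0) : MissingUpperBoundAt W p :=
  ReducibleUpperOfCoreInputs.missingUpperBoundAt_of_coreInputs' hne hmod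
    (exists_memberHullZetaCoreInputs_of_fineInputs_of_charForm hF hH hchar hFW) hCassels hGZK hmodL
    W p hp hng hnm hj hred hr

end Summit.BirchSwinnertonDyer.BirchSwinnertonDyer.Theorems.FineInputsCharForm

end
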